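import Mathlib
import HarnessLib
import Summits.ResolutionOfSingularities.ResolutionOfSingularities.Theorems.WildQuotientsWildQuotientResolutionS1aGraphTailLocal

/-!
# S1a — R4c cusp, brick (b4-root): RECENTRING AT THE FAR TANGENCY POINT `Q` and the tail memberships of both roots

[OURS · L1 W4.5c · lead-1 g17; plan-1 RULING R-F15v (2) ★ R4c `cusp_killsIn_two` (datum `σ : x₁ ↦ x₁ + x₀, x₂ ↦ x₂ + x₀, x₃ ↦ x₃ + (x₂² − x₁³)`), SPEC
`Cruxes/CyclicQuotientFourfolds/Lines/s1a_logminvertex-R4c-SPEC.md` §1 (1Q) and §3 (b4)] — NOT statements of the manuscript; counted 0; AI-level work, weaker than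
expert review. Crux stmt-ResolutionOfSingularities-17941 `CyclicQuotientFourfolds`, line `s1a-logminvertex` v13 (`stub_reachLowerInFX`).

* `FreeModel.exists_affineRecoord_shear` — the `k`-algebra automorphism `γ : x₁ ↦ x₁ + a, x₂ ↦ x₂ + x₁ + c` (`x₀, x₃` fixed) with its inverse;
* ★ `FreeModel.exists_cusp_recentre` — conjugating the two-moving-generator rows `x₁ ↦ x₁ + x₀, x₂ ↦ x₂ + x₀, x₃ ↦ x₃ + t` by `γ` gives the ONE-moving-generator rows
  `x₁ ↦ x₁ + x₀`, `x₂ ↦ x₂` (the new `x₂ = v = x₂ − x₁ + (a − c)` is EXACTLY INVARIANT), `x₃ ↦ x₃ + γt`;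
* `FreeModel.shear_cuspTail` — at a tangency point `(a, c)` of the cusp with the direction `(1,1)` (`2c = 3a²`, `c² = a³`): `γ(x₂² − x₁³) = x₂² + 2x₁x₂ + 2c·x₂ +
  (1 − 3a)x₁² − x₁³` (no terms of weight `< 2` for `(x₀ : 3, x₁ : 1, x₂ : 2)`); `FreeModel.exists_cusp_tangencyPoint` — `(a, c) = (4/9, 8/27)` in characteristic `≠ 2, 3`;
* `Cusp.cuspTail_mem` (`x₂² − x₁³ ∈ 𝒥₆(x₀ : 9, x₁ : 2, x₂ : 3)`, the root at `O`) and `Cusp.cuspTailQ_mem` (`γ(x₂² − x₁³) ∈ 𝒥₂(x₀ : 3, y : 1, v : 2)`, the ✓QhRoot at `Q`).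
-/

set_option linter.dupNamespace false

noncomputable section

open MvPolynomial
open Literature.AlgebraicGeometry.Resolution
open Summit.ResolutionOfSingularities.ResolutionOfSingularities.Theorems.WildQuotientResolution.S1
open Summit.ResolutionOfSingularities.ResolutionOfSingularities.Theorems.WildQuotientResolution.S1.KillCert

namespace Summit.ResolutionOfSingularities.ResolutionOfSingularities.Theorems.WildQuotientResolution.S1.FreeModel

/-- **Shear recoordination** `γ : x₀ ↦ x₀, x₁ ↦ x₁ + a, x₂ ↦ x₂ + x₁ + c, x₃ ↦ x₃` as a `k`-algebra automorphism of `k[x₀..x₃]`, with its inverse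
`x₁ ↦ x₁ − a, x₂ ↦ x₂ − x₁ + (a − c)`. [folklore] -/
theorem exists_affineRecoord_shear (k : Type) [Field k] (a c : k) :
    ∃ γ : MvPolynomial (Fin 4) k ≃ₐ[k] MvPolynomial (Fin 4) k, γ (X 0) = X 0 ∧ γ (X 1) = X 1 + C a ∧ γ (X 2) = X 2 + X 1 + C c ∧ γ (X 3) = X 3 ∧
      γ.symm (X 0) = X 0 ∧ γ.symm (X 1) = X 1 - C a ∧ γ.symm (X 2) = X 2 - X 1 + C (a - c) ∧ γ.symm (X 3) = X 3 := by
  let F : Fin 4 → MvPolynomial (Fin 4) k := ![X 0, X 1 + C a, X 2 + X 1 + C c, X 3]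
  let G' : Fin 4 → MvPolynomial (Fin 4) k := ![X 0, X 1 - C a, X 2 - X 1 + C (a - c), X 3]
  let f : MvPolynomial (Fin 4) k →ₐ[k] MvPolynomial (Fin 4) k := aeval F
  let g : MvPolynomial (Fin 4) k →ₐ[k] MvPolynomial (Fin 4) k := aeval G'
  have hf0 : f (X 0) = X 0 := aeval_X F 0
  have hf1 : f (X 1) = X 1 + C a := aeval_X F 1
  have hf2 : f (X 2) = X 2 + X 1 + C c := aeval_X F 2
  have hf3 : f (X 3) = X 3 := aeval_X F 3
  have hg0 : g (X 0) = X 0 := aeval_X G' 0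
  have hg1 : g (X 1) = X 1 - C a := aeval_X G' 1
  have hg2 : g (X 2) = X 2 - X 1 + C (a - c) := aeval_X G' 2
  have hg3 : g (X 3) = X 3 := aeval_X G' 3
  have hfC : ∀ a : k, f (C a) = C a := fun a => f.commutes a
  have hgC : ∀ a : k, g (C a) = C a := fun a => g.commutes a
  have hfg : f.comp g = AlgHom.id k _ := by
    refine algHom_ext fun l => ?_
    fin_cases l
    · change f (g (X 0)) = X 0; rw [hg0, hf0]
    · change f (g (X 1)) = X 1; rw [hg1, map_sub, hf1, hfC]; ring
    · change f (g (X 2)) = X 2; rw [hg2, map_add, map_sub, hf2, hf1, hfC, map_sub]; ring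
    · change f (g (X 3)) = X 3; rw [hg3, hf3]
  have hgf : g.comp f = AlgHom.id k _ := by
    refine algHom_ext fun l => ?_
    fin_cases l
    · change g (f (X 0)) = X 0; rw [hf0, hg0]
    · change g (f (X 1)) = X 1; rw [hf1, map_add, hg1, hgC]; ring
    · change g (f (X 2)) = X 2; rw [hf2, map_add, map_add, hg2, hg1, hgC, map_sub]; ring
    · change g (f (X 3)) = X 3; rw [hf3, hg3]
  exact ⟨AlgEquiv.ofAlgHom f g hfg hgf, hf0, hf1, hf2, hf3, hg0, hg1, hg2, hg3⟩

/-- ★ **RECENTRING THE CUSP DATUM AT `Q = (a, c)`**: conjugating the rows `x₀ ↦ x₀, x₁ ↦ x₁ + x₀, x₂ ↦ x₂ + x₀, x₃ ↦ x₃ + t` by the shear `γ` of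
`exists_affineRecoord_shear` gives `σ' = γ ∘ σ ∘ γ⁻¹` with rows `x₀ ↦ x₀`, `x₁ ↦ x₁ + x₀`, `x₂ ↦ x₂` (INVARIANT), `x₃ ↦ x₃ + γt`; in the new coordinates
`y = x₁ − a`, `v = x₂ − x₁ + (a − c)`. [OURS · L1 W4.5c · R4c; NOT a statement of the manuscript] -/
theorem exists_cusp_recentre (k : Type) [Field k] (σ : MvPolynomial (Fin 4) k ≃+* MvPolynomial (Fin 4) k) (hC : ∀ a : k, σ (C a) = C a)
    (h0 : σ (X 0) = X 0) (h1 : σ (X 1) = X 1 + X 0) (h2 : σ (X 2) = X 2 + X 0) (t : MvPolynomial (Fin 4) k) (h3 : σ (X 3) = X 3 + t) (a c : k) :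
    ∃ (γ : MvPolynomial (Fin 4) k ≃ₐ[k] MvPolynomial (Fin 4) k) (σ' : MvPolynomial (Fin 4) k ≃+* MvPolynomial (Fin 4) k),
      (∀ x, σ' x = γ (σ (γ.symm x))) ∧
      γ (X 0) = X 0 ∧ γ (X 1) = X 1 + C a ∧ γ (X 2) = X 2 + X 1 + C c ∧ γ (X 3) = X 3 ∧
      γ.symm (X 0) = X 0 ∧ γ.symm (X 1) = X 1 - C a ∧ γ.symm (X 2) = X 2 - X 1 + C (a - c) ∧ γ.symm (X 3) = X 3 ∧
      (∀ a : k, σ' (C a) = C a) ∧ σ' (X 0) = X 0 ∧ σ' (X 1) = X 1 + X 0 ∧ σ' (X 2) = X 2 ∧ σ' (X 3) = X 3 + γ t := by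
  obtain ⟨γ, hγ0, hγ1, hγ2, hγ3, hγs0, hγs1, hγs2, hγs3⟩ := exists_affineRecoord_shear k a c
  let σ' : MvPolynomial (Fin 4) k ≃+* MvPolynomial (Fin 4) k := (γ.symm.toRingEquiv.trans σ).trans γ.toRingEquiv
  have hσ' : ∀ x, σ' x = γ (σ (γ.symm x)) := fun _ => rfl
  have hγC : ∀ a : k, γ (C a) = C a := fun a => γ.commutes a
  have hγsC : ∀ a : k, γ.symm (C a) = C a := fun a => γ.symm.commutes a
  refine ⟨γ, σ', hσ', hγ0, hγ1, hγ2, hγ3, hγs0, hγs1, hγs2, hγs3, fun a => ?_, ?_, ?_, ?_, ?_⟩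
  · rw [hσ', hγsC, hC, hγC]
  · rw [hσ', hγs0, h0, hγ0]
  · rw [hσ', hγs1, map_sub, h1, hC, map_sub, map_add, hγ1, hγ0, hγC]; ring
  · rw [hσ', hγs2, map_add, map_sub, h2, h1, hC, map_add, map_sub, map_add, map_add, hγ2, hγ0, hγ1, hγC, map_sub]; ring
  · rw [hσ', hγs3, h3, map_add, hγ3]

/-- **The cusp tail in the `Q`-coordinates**: if `(a, c)` is a tangency point of `x₂² = x₁³` with the direction `(1, 1)` (`2c = 3a²`, `c² = a³`), the shear `γ`
sends `x₂² − x₁³` to `x₂² + 2x₁x₂ + 2c·x₂ + (1 − 3a)x₁² − x₁³` (the terms of `x₁`-degree `≤ 1` cancel). [OURS · L1 W4.5c · R4c] -/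
theorem shear_cuspTail {k : Type} [Field k] (γ : MvPolynomial (Fin 4) k ≃ₐ[k] MvPolynomial (Fin 4) k) {a c : k}
    (hγ1 : γ (X 1) = X 1 + C a) (hγ2 : γ (X 2) = X 2 + X 1 + C c) (hQ1 : 2 * c = 3 * a ^ 2) (hQ2 : c ^ 2 = a ^ 3) :
    γ (X 2 ^ 2 - X 1 ^ 3) = X 2 ^ 2 + 2 * X 1 * X 2 + C (2 * c) * X 2 + C (1 - 3 * a) * X 1 ^ 2 - X 1 ^ 3 := by
  rw [map_sub, map_pow, map_pow, hγ1, hγ2, map_mul, map_sub, map_mul, C_1,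
    show (C (2 : k) : MvPolynomial (Fin 4) k) = 2 from map_ofNat C 2, show (C (3 : k) : MvPolynomial (Fin 4) k) = 3 from map_ofNat C 3]
  have hQ1' : (2 : MvPolynomial (Fin 4) k) * C c = 3 * C a ^ 2 := by
    rw [← map_pow, ← map_ofNat C 2, ← map_ofNat C 3, ← map_mul, ← map_mul, hQ1]
  have hQ2' : (C c : MvPolynomial (Fin 4) k) ^ 2 = C a ^ 3 := by rw [← map_pow, ← map_pow, hQ2]
  linear_combination X 1 * hQ1' + hQ2'

/-- **The far tangency point exists in characteristic `≠ 2, 3`**: `(a, c) = (4/9, 8/27)`, `a ≠ 0`. [OURS · L1 W4.5c · R4c] -/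
theorem exists_cusp_tangencyPoint {k : Type} [Field k] (h2 : (2 : k) ≠ 0) (h3 : (3 : k) ≠ 0) :
    ∃ a c : k, a ≠ 0 ∧ 2 * c = 3 * a ^ 2 ∧ c ^ 2 = a ^ 3 := by
  refine ⟨4 / 9, 8 / 27, ?_, ?_, ?_⟩
  · have h4 : (4 : k) ≠ 0 := by
      have : (4 : k) = 2 * 2 := by norm_num
      rw [this]; exact mul_ne_zero h2 h2
    have h9 : (9 : k) ≠ 0 := by
      have : (9 : k) = 3 * 3 := by norm_num
      rw [this]; exact mul_ne_zero h3 h3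
    exact div_ne_zero h4 h9
  · have h9 : (9 : k) ≠ 0 := by
      have : (9 : k) = 3 * 3 := by norm_num
      rw [this]; exact mul_ne_zero h3 h3
    have h27 : (27 : k) ≠ 0 := by
      have : (27 : k) = 3 * 3 * 3 := by norm_num
      rw [this]; exact mul_ne_zero (mul_ne_zero h3 h3) h3
    field_simp
    norm_num
  · have h9 : (9 : k) ≠ 0 := by
      have : (9 : k) = 3 * 3 := by norm_num
      rw [this]; exact mul_ne_zero h3 h3
    have h27 : (27 : k) ≠ 0 := by
      have : (27 : k) = 3 * 3 * 3 := by norm_num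
      rw [this]; exact mul_ne_zero (mul_ne_zero h3 h3) h3
    field_simp
    norm_num

/-- The `(1,1)`-tangency points of the cusp are `x₁ ∈ {0, 4/9}`: from `2c = 3a²` and `c² = a³` with `a ≠ 0`, `9a = 4` (so `a = 4/9`, `c = 8/27`). [OURS · L1 W4.5c · R4c] -/
theorem cusp_tangencyPoint_eq {k : Type} [Field k] {a c : k} (ha : a ≠ 0) (hQ1 : 2 * c = 3 * a ^ 2) (hQ2 : c ^ 2 = a ^ 3) : 9 * a = 4 := by
  have h : 4 * c ^ 2 = 9 * a ^ 4 := by linear_combination (2 * c + 3 * a ^ 2) * hQ1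
  rw [hQ2] at h
  have h' : a ^ 3 * (9 * a - 4) = 0 := by linear_combination -h
  rcases mul_eq_zero.mp h' with h3 | h4
  · exact absurd (pow_eq_zero_iff (n := 3) (by norm_num) |>.mp h3) ha
  · exact sub_eq_zero.mp h4

end Summit.ResolutionOfSingularities.ResolutionOfSingularities.Theorems.WildQuotientResolution.S1.FreeModel

namespace Summit.ResolutionOfSingularities.ResolutionOfSingularities.Theorems.WildQuotientResolution.S1.Cusp

variable {k : Type} [Field k]

/-- **The cusp tail lies in `𝒥₆`** of the root at `O`, centre `(x₀ : 9, x₁ : 2, x₂ : 3)` (`x₂²`, `x₁³` both of weight `6`). [OURS · L1 W4.5c · R4c] -/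
theorem cuspTail_mem :
    (X 2 ^ 2 - X 1 ^ 3 : MvPolynomial (Fin 4) k) ∈
      (weightedFiltration (fun i => (X ((![0, 1, 2] : Fin 3 → Fin 4) i) : MvPolynomial (Fin 4) k)) ![9, 2, 3]).ideal 6 := by
  have h2 := GameFrame.GModel.pow_mem_weightedFiltration_ideal (fun i => (X ((![0, 1, 2] : Fin 3 → Fin 4) i) : MvPolynomial (Fin 4) k)) ![9, 2, 3] 2 2
  have h1 := GameFrame.GModel.pow_mem_weightedFiltration_ideal (fun i => (X ((![0, 1, 2] : Fin 3 → Fin 4) i) : MvPolynomial (Fin 4) k)) ![9, 2, 3] 1 3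
  rw [show 2 * (![9, 2, 3] : Fin 3 → ℕ) 2 = 6 from rfl] at h2
  rw [show 3 * (![9, 2, 3] : Fin 3 → ℕ) 1 = 6 from rfl] at h1
  exact sub_mem h2 h1

/-- **The recentred cusp tail lies in `𝒥₂`** of the root at `Q`, centre `(x₀ : 3, y : 1, v : 2)` (`v²: 4`, `yv: 3`, `v: 2`, `y²: 2`, `y³: 3`). [OURS · L1 W4.5c · R4c] -/
theorem cuspTailQ_mem (a c : k) :
    (X 2 ^ 2 + 2 * X 1 * X 2 + C (2 * c) * X 2 + C (1 - 3 * a) * X 1 ^ 2 - X 1 ^ 3 : MvPolynomial (Fin 4) k) ∈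
      (weightedFiltration (fun i => (X ((![0, 1, 2] : Fin 3 → Fin 4) i) : MvPolynomial (Fin 4) k)) ![3, 1, 2]).ideal 2 := by
  have hv : (X 2 : MvPolynomial (Fin 4) k) ∈ (weightedFiltration (fun i => (X ((![0, 1, 2] : Fin 3 → Fin 4) i) : MvPolynomial (Fin 4) k)) ![3, 1, 2]).ideal 2 :=
    mem_weightedFiltration_ideal (fun i => (X ((![0, 1, 2] : Fin 3 → Fin 4) i) : MvPolynomial (Fin 4) k)) ![3, 1, 2] 2
  have hy2 := GameFrame.GModel.pow_mem_weightedFiltration_ideal (fun i => (X ((![0, 1, 2] : Fin 3 → Fin 4) i) : MvPolynomial (Fin 4) k)) ![3, 1, 2] 1 2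
  have hy3 := GameFrame.GModel.pow_mem_weightedFiltration_ideal (fun i => (X ((![0, 1, 2] : Fin 3 → Fin 4) i) : MvPolynomial (Fin 4) k)) ![3, 1, 2] 1 3
  rw [show 2 * (![3, 1, 2] : Fin 3 → ℕ) 1 = 2 from rfl] at hy2
  rw [show 3 * (![3, 1, 2] : Fin 3 → ℕ) 1 = 3 from rfl] at hy3
  refine sub_mem (add_mem (add_mem (add_mem ?_ ?_) (Ideal.mul_mem_left _ _ hv)) (Ideal.mul_mem_left _ _ hy2)) ((weightedFiltration _ _).antitone (show (2 : ℕ) ≤ 3 by norm_num) hy3)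
  · rw [pow_two]; exact Ideal.mul_mem_left _ _ hv
  · exact Ideal.mul_mem_left _ _ hv

end Summit.ResolutionOfSingularities.ResolutionOfSingularities.Theorems.WildQuotientResolution.S1.Cusp

end
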